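import Mathlib
import Summits.CriticalPhenomena.Ising3DConformalLimit.Theses.PrecisionLaplacian

/-!
# Sketch — first lemmas of the three crux idea cards for
`PrecisionLaplacian.DirectCorrelationStableTail` (item stmt-CriticalPhenomena-4799), round 1, ideator 1.

Statements only (`def … : Prop`), elaborated against Mathlib + the route file; nothing is proved here.
-/

noncomputable section

open MeasureTheory Filter Set
open scoped BigOperators

namespace Summit.CriticalPhenomena.Ising3DConformalLimit.Cruxes.DirectCorrelationStableTail.Sketch

open Literature.Probability.LatticeModels

/-- The crux hypothesis `H_pot` (symmetric-potential property of the critical kernel), verbatim from the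
route file. -/
def SymmetricPotentialHyp : Prop :=
  ∀ A : Finset (Site 3), (Matrix.of fun (p q : ↥A) => criticalTwoPoint 3 (q.1 - p.1)).PosDef ∧
    ∀ u v : ↥A, (u ≠ v → (Matrix.of fun (p q : ↥A) => criticalTwoPoint 3 (q.1 - p.1))⁻¹ u v ≤ 0) ∧
      0 ≤ ∑ w, (Matrix.of fun (p q : ↥A) => criticalTwoPoint 3 (q.1 - p.1))⁻¹ u w

/-- The direct correlation function `a(x) = inf_{A ∋ 0,x} −(G_A)⁻¹(0,x)`, verbatim from the crux. -/
def dcf (x : Site 3) : ℝ :=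
  ⨅ A : {A : Finset (Site 3) // (0 : Site 3) ∈ A ∧ x ∈ A},
    -((Matrix.of fun (p q : ↥A.1) => criticalTwoPoint 3 (q.1 - p.1))⁻¹ ⟨0, A.2.1⟩ ⟨x, A.2.2⟩)

/-! ## Card 1 — pick-inversion-complete-monotonicity -/

/-- FIRST LEMMA (pure one-variable analysis; Pick/Nevanlinna inversion of a Källén–Lehmann symbol).
If `g(n) = ∫ t^{|n|} dν(t)` is a summable Hausdorff-moment sequence (`ν` finite on `[0,1)`,
`∫ (1-t)⁻¹ dν < ∞`), then the reciprocal of its (positive) symbol `ĝ(k) = Σ_n g(n) cos(nk)` has the form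
`A − β cos k − Σ_{|n| ≥ 2} (∫ t^{|n|} dτ) cos(nk)` with `β ≥ 0` and `τ` a finite measure on `[0,1)`:
the negative Fourier coefficients of `1/ĝ` from order two on form a Hausdorff moment sequence. -/
def PickInversionCM : Prop :=
  ∀ (ν : Measure ℝ), IsFiniteMeasure ν → ν (Set.Ico (0:ℝ) 1)ᶜ = 0 →
    Integrable (fun t : ℝ => (1 - t)⁻¹) ν →
    ∃ (A β : ℝ) (τ : Measure ℝ), IsFiniteMeasure τ ∧ 0 ≤ β ∧ τ (Set.Ico (0:ℝ) 1)ᶜ = 0 ∧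
      ∀ k : ℝ,
        (∑' n : ℤ, (∫ t, t ^ n.natAbs ∂ν) * Real.cos (n * k))⁻¹ =
          A - β * Real.cos k -
            ∑' n : ℤ, (if 2 ≤ n.natAbs then (∫ t, t ^ n.natAbs ∂τ) * Real.cos (n * k) else 0)

/-- Crux-level consequence (the line's first statement about the crux's own objects): under `H_pot`,
the direct correlation function is COMPLETELY MONOTONE along every coordinate axis from distance 2 on,
`a(n eᵢ) = ∫_{[0,1)} tⁿ dτᵢ(t)` for `n ≥ 2`. (Uses the axis Källén–Lehmann representation
`AizenmanDuminilCopin2021_prop_8_6` in every transverse Fourier mode + `PickInversionCM`.) -/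
def AxialCompleteMonotonicity : Prop :=
  SymmetricPotentialHyp → ∀ i : Fin 3, ∃ τ : Measure ℝ, IsFiniteMeasure τ ∧ τ (Set.Ico (0:ℝ) 1)ᶜ = 0 ∧
    ∀ n : ℕ, 2 ≤ n → dcf (Pi.single i (n : ℤ)) = ∫ t, t ^ n ∂τ

/-- Axis dominance, also forced by the Pick inversion (test function `δ₀ − δ_z` in the transverse plane):
`a(n eᵢ + z) ≤ a(n eᵢ)` for `n ≥ 2` and `z ⊥ eᵢ`. -/
def AxisDominance : Prop :=
  SymmetricPotentialHyp → ∀ (i : Fin 3) (n : ℕ) (z : Site 3), 2 ≤ n → z i = 0 →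
    dcf (Pi.single i (n : ℤ) + z) ≤ dcf (Pi.single i (n : ℤ))

/-! ## Card 2 — nine-transfer-matrices-uv-analyticity -/

/-- FIRST LEMMA (one variable): the symbol of a summable Källén–Lehmann sequence extends holomorphically
to `ℂ ∖ (2πℤ + iℝ)` — a domain that does not depend on the measure. (Stieltjes structure of
`Σ_n t^{|n|} e^{ink} = (1 - t²)/(1 - 2t cos k + t²)` in `cos k`, with representing measure on `[1, ∞)`
because `t ∈ [0,1)`, i.e. because the transfer matrix is positive.) -/
def KLSymbolHolomorphic : Prop :=
  ∀ (ν : Measure ℝ), IsFiniteMeasure ν → ν (Set.Ico (0:ℝ) 1)ᶜ = 0 →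
    Integrable (fun t : ℝ => (1 - t)⁻¹) ν →
    ∃ F : ℂ → ℂ, DifferentiableOn ℂ F {z : ℂ | ∀ m : ℤ, z.re ≠ 2 * Real.pi * m} ∧
      (∀ z : ℂ, (∀ m : ℤ, z.re ≠ 2 * Real.pi * m) →
        ‖F z‖ ≤ (⨆ t : Set.Ico (0:ℝ) 1, ‖(1 - (t:ℂ) ^ 2) / (1 - 2 * (t:ℂ) * Complex.cos z + (t:ℂ) ^ 2)‖) *
          (ν Set.univ).toReal) ∧
      ∀ k : ℝ, (∀ m : ℤ, k ≠ 2 * Real.pi * m) →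
        F k = ((∑' n : ℤ, (∫ t, t ^ n.natAbs ∂ν) * Real.cos (n * k) : ℝ) : ℂ)

/-! ## Card 3 — truncated-variance-dictionary -/

/-- SUPPORT LEMMA (pure, provable now): two-sided comparison of the Lévy–Khintchine symbol of a
nonnegative summable cubic-symmetric `a` on `ℤ³` with Feller's truncated-second-moment functional at the
dual scale, `ψ_a(k) ≍ Σ_x a(x) min(1, ‖k‖²|x|²)`. -/
def LevySymbolSandwich : Prop :=
  ∃ c C : ℝ, 0 < c ∧ 0 < C ∧ ∀ a : Site 3 → ℝ, (∀ x, 0 ≤ a x) → Summable a →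
    (∀ (x : Site 3) (σ : Equiv.Perm (Fin 3)), a (x ∘ σ) = a x) →
    (∀ (x : Site 3) (i : Fin 3), a (Function.update x i (-x i)) = a x) →
    ∀ k : Fin 3 → ℝ, k ≠ 0 →
      c * (∑' x, a x * min 1 (‖k‖ ^ 2 * ∑ i, ((x i : ℝ)) ^ 2)) ≤
          ∑' x, a x * (1 - Real.cos (∑ i, k i * x i)) ∧
        (∑' x, a x * (1 - Real.cos (∑ i, k i * x i))) ≤
          C * ∑' x, a x * min 1 (‖k‖ ^ 2 * ∑ i, ((x i : ℝ)) ^ 2)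

/-- FIRST LEMMA (crux objects; 'Spitzer rigidity of the diffusive branch'): under `H_pot`, if the direct
correlation function has a finite second moment then the critical two-point function is asymptotically
an ISOTROPIC pure Coulomb law, `G(x)·|x|₂ → c > 0` (Spitzer P26.1 for the Ornstein–Zernike walk with
step law `a/A₀`; cubic symmetry makes the covariance scalar). In this branch the crux conclusion fails
(`η = 0`), so every proof of the crux must exclude it — this is where `η(3) > 0` enters. -/
def DiffusiveBranchCoulomb : Prop :=
  SymmetricPotentialHyp → Summable (fun x : Site 3 => dcf x * ∑ i, ((x i : ℝ)) ^ 2) →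
    ∃ c : ℝ, 0 < c ∧
      Tendsto (fun x : Site 3 => criticalTwoPoint 3 x * Real.sqrt (∑ i, ((x i : ℝ)) ^ 2)) cofinite (nhds c)

/-- The dichotomy quantity of card 3 read against the susceptibility: under `H_pot`, finiteness of the
second moment of `a` is equivalent to saturation of the infrared bound in x-space,
`liminf_n n·G(n e₁) > 0` (negation of `PerfectScreening.NonSat`). -/
def FiniteVarianceIffSaturation : Prop :=
  SymmetricPotentialHyp →
    (Summable (fun x : Site 3 => dcf x * ∑ i, ((x i : ℝ)) ^ 2) ↔
      ∃ c : ℝ, 0 < c ∧ ∀ n : ℕ, 1 ≤ n → c ≤ n * criticalTwoPoint 3 (Pi.single 0 (n : ℤ)))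


/-! ## Card (filed) — nine-frame-cross-analyticity -/

/-- The Lévy–Khintchine symbol of the direct correlation function, `ψ(k) = −Σ_y m(y) cos(k·y)` with
`m = dcf` (`m(0) = −A₀`, `m(y) = a(y) ≥ 0` for `y ≠ 0`); under `H_pot` and conservativity this is
`1/Ĝ(k)` (support `PrecisionIsLaplacian`). -/
def precisionSymbol (k : Fin 3 → ℝ) : ℝ :=
  - ∑' y : Site 3, dcf y * Real.cos (∑ i, k i * y i)

/-- CRUX-LEVEL TARGET of the card: under `H_pot` the precision symbol `ψ = 1/Ĝ` is REAL-ANALYTIC on the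
torus minus the origin (`k ∉ 2πℤ³`): the critical propagator has no singular momentum other than `0`, so
the direct correlation function equals its infrared germ part up to an exponentially small remainder.
Mechanism: nine positive transfer frames (Stieltjes in `cos (k·u)`, support `[1,∞)`) + the infrared bound
(`|S(z)| ≤ S(Re z) ≤ C/(1 − cos Re(k·u))`) + the Bernstein–Siciak cross theorem. -/
def UVAnalyticPrecisionSymbol : Prop :=
  SymmetricPotentialHyp →
    AnalyticOnNhd ℝ precisionSymbol {k : Fin 3 → ℝ | ¬ ∀ i : Fin 3, ∃ m : ℤ, k i = 2 * Real.pi * m}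

/-- One-variable domination lemma used for the uniform bounds of the cross theorem: a Stieltjes
transform with representing measure on `[1, ∞)` is dominated off the cut by its value at the real part. -/
def StieltjesDominatedByRealPart : Prop :=
  ∀ (ρ : Measure ℝ), ρ (Set.Ici (1:ℝ))ᶜ = 0 → ∀ z : ℂ, z.re < 1 →
    Integrable (fun c : ℝ => (c - z.re)⁻¹) ρ →
      ‖∫ c, ((c : ℂ) - z)⁻¹ ∂ρ‖ ≤ ∫ c, (c - z.re)⁻¹ ∂ρ

/-- LINEAR MOMENTUM-RESOLVED GAP (the quantitative by-product, stated on the axis frame through the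
tree's spectral representation vocabulary): there is `c > 0` such that for every finitely supported real
test function `v` on the plane `{x₀ = 0}` whose plane Fourier transform vanishes on `{|q| < r}`… — kept
informal in the card (needs the `ℓ²` form of ADC Prop. 8.6); typed proxy: exponential decay of smoothly
momentum-filtered transverse modes. -/
def FilteredTransverseModesDecay : Prop :=
  ∃ c : ℝ, 0 < c ∧ ∀ (r : ℝ), 0 < r → r ≤ Real.pi →
    ∀ w : (Fin 2 → ℤ) → ℝ, (Summable fun z => |w z| * (1 + ‖z‖) ^ 4) →
      (∀ q : Fin 2 → ℝ, (∑ i, q i ^ 2) < r ^ 2 → (∑' z : Fin 2 → ℤ, w z * Real.cos (∑ i, q i * z i)) = 0) →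
      ∃ C : ℝ, ∀ n : ℕ,
        |∑' z : Fin 2 → ℤ, w z * criticalTwoPoint 3 (Fin.cons (n : ℤ) z)| ≤ C * Real.exp (-c * r * n)

end Summit.CriticalPhenomena.Ising3DConformalLimit.Cruxes.DirectCorrelationStableTail.Sketch
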